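import Summits.HodgeConjecture.HodgeConjecture.Theorems.PadicSemiregularLiftHodgeFermatVarietiesFibreOfTopLevelGeneral
import Summits.HodgeConjecture.HodgeConjecture.Theorems.PadicSemiregularLiftHodgeFermatVarietiesExistsFibreOfNotPaired
import HarnessLib

/-!
# Aoki's Theorem A one prime down, II: a non-paired Hodge `(p+1)`-tuple contains `p - 1` points of a `p`-progression — line `cancel-by-any-claim-lattice`, crux `HodgeFermatVarieties` (stmt-HodgeConjecture-1334)

Lead c4's programme GP, registered stubs GP-L2a `stub_fibre_of_top_level_general` (the registered form of
`fibre_of_top_level_general`, file `…FibreOfTopLevelGeneral`) and GP-L2 `stub_exists_fibre_of_not_paired_general`: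
for a prime `p₁ ≥ 5` and a level `m` with all prime factors `≥ p₁`, `p₁² ∤ m`, `p₁(p₁+2) ∤ m`, a Hodge multiset `s`
of `p₁ + 1` elements of `ℤ/m` with `count x s ≠ count (-x) s` for some `x` contains all but one of the points
`A + j(m/p₁)` (`j < p₁`) of a progression with `p₁ A ≠ 0`. Word for word the sextuple file `…ExistsFibreOfNotPaired`
(whose helper lemmas are imported) with `5 ↦ p₁`.

References: [Aoki1983] N. Aoki, Math. Ann. 266 (1983) 23–54, Thm. A′ (§7), Prop. 2.1.
-/

-- every sibling file of the line declares into `…CancelByAnyClaimLattice.PairedNull` from a differently named module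
set_option linter.dupNamespace false

noncomputable section

open Finset
open Literature.AlgebraicGeometry.HodgeTheory Literature.AlgebraicGeometry.HodgeTheory.FermatCharacter

namespace Summit.HodgeConjecture.HodgeConjecture.Theorems.CancelByAnyClaimLattice

namespace PairedNull

section ProgressionGeneral

variable {m : ℕ} [NeZero m]

/-- **GP-L2 `stub_exists_fibre_of_not_paired_general`** — for a prime `p₁ ≥ 5`, a non-paired Hodge
`(p₁+1)`-multiset at a level `m` with all prime factors `≥ p₁`, `p₁² ∤ m`, `p₁(p₁+2) ∤ m`, contains all but one of
the `p₁` points of a progression `{A + j(m/p₁)}` with `p₁ A ≠ 0` (from `fibre_of_top_level_general` at the top non-even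
level `M = p₁ n`: `A = (m/M)·⟨crt⁻¹(0, b)⟩`, `j₀ = 0` the non-unit point of the fibre). [cite: Aoki1983, Thm. A′ (§7)] -/
theorem stub_exists_fibre_of_not_paired_general : ∀ (p₁ : ℕ), p₁.Prime → 5 ≤ p₁ → ∀ (m : ℕ) [NeZero m], (∀ q ∈ m.primeFactors, p₁ ≤ q) → ¬ p₁ * p₁ ∣ m → ¬ p₁ * (p₁ + 2) ∣ m → ∀ s : Multiset (ZMod m), IsHodgeMultiset s → Multiset.card s = p₁ + 1 → (∃ x : ZMod m, Multiset.count x s ≠ Multiset.count (-x) s) → p₁ ∣ m ∧ ∃ A : ZMod m, (p₁ : ZMod m) * A ≠ 0 ∧ ∃ j₀ : ℕ, j₀ < p₁ ∧ ∀ j : ℕ, j < p₁ → j ≠ j₀ → A + (j : ZMod m) * ((m / p₁ : ℕ) : ZMod m) ∈ s := by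
  intro p₁ hp₁ hp₁5 m _ hmin hsq htwin s hs h6 hns
  classical
  have hm0 : m ≠ 0 := NeZero.ne m
  obtain ⟨r, α, hα, rfl⟩ := hs.exists_isHodge
  have hr : r = p₁ + 1 := by rw [card_univ_val_map] at h6; exact h6
  subst hr
  -- the non-even level of some entry
  obtain ⟨x, hx⟩ := hns
  rw [count_univ_val_map, count_univ_val_map] at hx
  have hx0 : x ≠ 0 := by
    rintro rfl
    rw [neg_zero] at hx
    exact hx rfl
  have hfibre : ∀ (M : ℕ) (y : ZMod m), m / m.gcd y.val = M →
      (univ.filter fun i : Fin (p₁ + 1) ↦ α i = y) =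
        univ.filter fun i : Fin (p₁ + 1) ↦ m / m.gcd (α i).val = M ∧
          ((((α i).val / (m / M)) : ℕ) : ZMod M) = (((y.val / (m / M)) : ℕ) : ZMod M) := by
    intro M y hy
    ext i
    simp only [mem_filter, mem_univ, true_and]
    constructor
    · rintro rfl; exact ⟨hy, rfl⟩
    · rintro ⟨hli, hri⟩
      exact eq_of_level_eq_of_unitPart_eq hli hy hri
  set P : ℕ → Prop := fun d ↦ ∃ M : ℕ, M ∣ m ∧ m / M = d ∧ ∃ v : ZMod M,
      #(univ.filter fun i : Fin (p₁ + 1) ↦ m / m.gcd (α i).val = M ∧ ((((α i).val / (m / M)) : ℕ) : ZMod M) = -v) ≠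
      #(univ.filter fun i : Fin (p₁ + 1) ↦ m / m.gcd (α i).val = M ∧ ((((α i).val / (m / M)) : ℕ) : ZMod M) = v) with hP
  have hPex : ∃ d, P d := by
    refine ⟨m / (m / m.gcd x.val), m / m.gcd x.val, level_dvd x, rfl, (((x.val / (m / (m / m.gcd x.val))) : ℕ)), ?_⟩
    rw [← unitPart_neg hx0 rfl, ← hfibre _ (-x) (level_neg x), ← hfibre _ x rfl]
    exact Ne.symm hx
  -- the top non-even level `M` (least `d = m / M`)
  obtain ⟨M, hMm, hdM, hne⟩ := Nat.find_spec hPex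
  have hM0 : M ≠ 0 := fun h0 ↦ hm0 (by rw [h0] at hMm; exact zero_dvd_iff.mp hMm)
  have hIH : ∀ M' : ℕ, M' ∣ m → M ∣ M' → M' ≠ M → ∀ u : ZMod M',
      #(univ.filter fun i : Fin (p₁ + 1) ↦ m / m.gcd (α i).val = M' ∧ ((((α i).val / (m / M')) : ℕ) : ZMod M') = -u) =
      #(univ.filter fun i : Fin (p₁ + 1) ↦ m / m.gcd (α i).val = M' ∧ ((((α i).val / (m / M')) : ℕ) : ZMod M') = u) := by
    intro M' hM'm hMM' hneM u
    have hM'0 : M' ≠ 0 := fun h0 ↦ hm0 (by rw [h0] at hM'm; exact zero_dvd_iff.mp hM'm)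
    have hlt : m / M' < Nat.find hPex := by
      rw [← hdM]
      obtain ⟨t, rfl⟩ := hMM'
      obtain ⟨s', hs'⟩ := hM'm
      have ht1 : t ≠ 1 := fun h1 ↦ hneM (by rw [h1, mul_one])
      have ht0 : t ≠ 0 := fun h0 ↦ hM'0 (by rw [h0, mul_zero])
      have hs0 : 0 < s' := Nat.pos_of_ne_zero fun h0 ↦ hm0 (by rw [hs', h0, mul_zero])
      have h1 : m / (M * t) = s' := by rw [hs', Nat.mul_div_cancel_left _ (Nat.pos_of_ne_zero hM'0)]
      have h2 : m / M = t * s' := by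
        rw [hs', mul_assoc, Nat.mul_div_cancel_left _ (Nat.pos_of_ne_zero hM0)]
      rw [h1, h2]
      calc s' = 1 * s' := (one_mul s').symm
        _ < t * s' := Nat.mul_lt_mul_of_lt_of_le (by omega) (le_refl s') hs0
    have hmin := Nat.find_min hPex hlt
    simp only [hP, not_exists, not_and, not_not] at hmin
    exact hmin M' hM'm rfl u
  obtain ⟨n, hc, hMn, hn1, b, hbu, hfib⟩ := fibre_of_top_level_general hp₁ hp₁5 rfl hmin hsq htwin hα hMm hne hIH
  subst hMn
  have hn0 : n ≠ 0 := by omega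
  haveI : NeZero n := ⟨hn0⟩
  have hp0 : p₁ ≠ 0 := hp₁.ne_zero
  haveI : NeZero p₁ := ⟨hp0⟩
  have hpm : p₁ ∣ m := (dvd_mul_right p₁ n).trans hMm
  obtain ⟨k, hk⟩ := hMm
  have hk0 : k ≠ 0 := fun h0 ↦ hm0 (by rw [hk, h0, mul_zero])
  have hdivpn : m / (p₁ * n) = k := by rw [hk, Nat.mul_div_cancel_left _ (by positivity)]
  have hdivp : m / p₁ = n * k := by rw [hk, mul_assoc, Nat.mul_div_cancel_left _ hp₁.pos]
  have hdivn : m / n = p₁ * k := by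
    rw [hk, show p₁ * n * k = n * (p₁ * k) by ring, Nat.mul_div_cancel_left _ (Nat.pos_of_ne_zero hn0)]
  -- the base point `x₀ = crt⁻¹(0, b)` and `A = (m/(p₁ n))·⟨x₀⟩`
  set x₀ : ZMod (p₁ * n) := (ZMod.chineseRemainder hc).symm (0, b) with hx₀
  refine ⟨hpm, ((m / (p₁ * n) : ℕ) : ZMod m) * ((x₀.val : ℕ) : ZMod m), ?_, 0, hp₁.pos, fun j hj hj0 ↦ ?_⟩
  · -- `p₁ A ≠ 0`: `p₁ A = (m/n)·⟨x₀⟩` and `n ∤ ⟨x₀⟩` as `x₀ ≡ b (mod n)`, `b` a unit, `n > 1`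
    intro h0
    have h5A : (p₁ : ZMod m) * (((m / (p₁ * n) : ℕ) : ZMod m) * ((x₀.val : ℕ) : ZMod m)) =
        ((m / n * x₀.val : ℕ) : ZMod m) := by
      rw [hdivn, hdivpn]; push_cast; ring
    rw [h5A, divMul_natCast_eq_zero_iff ((dvd_mul_left n p₁).trans ⟨k, hk⟩)] at h0
    have hb : (ZMod.castHom (dvd_mul_left n p₁) (ZMod n)) x₀ = b := (castHom_crt_symm hc 0 b).2
    rw [ZMod.castHom_apply, ZMod.cast_eq_val, (ZMod.natCast_eq_zero_iff _ _).mpr h0] at hb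
    haveI : Fact (1 < n) := ⟨hn1⟩
    exact hbu.ne_zero hb.symm
  · -- the point `A + j(m/p₁)` is the entry above `crt⁻¹(jn, b)`
    have hjn5 : ¬ p₁ ∣ j * n := fun hd ↦ by
      rcases (Nat.Prime.dvd_mul hp₁).mp hd with hd | hd
      · exact absurd (Nat.le_of_dvd (by omega) hd) (by omega)
      · exact (Nat.Prime.coprime_iff_not_dvd hp₁).mp hc hd
    have hy0 : ((j * n : ℕ) : ZMod p₁) ≠ 0 := by rwa [Ne, ZMod.natCast_eq_zero_iff]
    haveI : Fact (Nat.Prime p₁) := ⟨hp₁⟩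
    have hyu : IsUnit ((j * n : ℕ) : ZMod p₁) := isUnit_iff_ne_zero.mpr hy0
    obtain ⟨i, hlev, hup⟩ := hfib hyu.unit
    rw [IsUnit.unit_spec] at hup
    -- `crt⁻¹(jn, b) = x₀ + jn`
    have hxj : (ZMod.chineseRemainder hc).symm (((j * n : ℕ) : ZMod p₁), b) =
        x₀ + ((j * n : ℕ) : ZMod (p₁ * n)) := by
      have h1 : ZMod.castHom (dvd_mul_right p₁ n) (ZMod p₁) (x₀ + ((j * n : ℕ) : ZMod (p₁ * n))) =
          ((j * n : ℕ) : ZMod p₁) := by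
        rw [map_add, map_natCast, hx₀, (castHom_crt_symm hc 0 b).1, zero_add]
      have h2 : ZMod.castHom (dvd_mul_left n p₁) (ZMod n) (x₀ + ((j * n : ℕ) : ZMod (p₁ * n))) = b := by
        rw [map_add, map_natCast, hx₀, (castHom_crt_symm hc 0 b).2, Nat.cast_mul, ZMod.natCast_self, mul_zero,
          add_zero]
      rw [← h1, ← h2]
      exact crt_symm_castHom hc _
    have hαi : α i = ((m / (p₁ * n) : ℕ) : ZMod m) * ((x₀.val : ℕ) : ZMod m) +
        (j : ZMod m) * ((m / p₁ : ℕ) : ZMod m) := by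
      rw [eq_divMul_unitPart hlev, hup, hxj, divMul_val_add ⟨k, hk⟩]
      congr 1
      have hval : (((j * n : ℕ) : ZMod (p₁ * n))).val = j * n := by
        rw [ZMod.val_natCast, Nat.mod_eq_of_lt (by nlinarith [Nat.pos_of_ne_zero hn0])]
      rw [hval, hdivpn, hdivp]
      push_cast
      ring
    rw [← hαi]
    exact Multiset.mem_map_of_mem _ (Finset.mem_univ_val i)


end ProgressionGeneral

end PairedNull

end Summit.HodgeConjecture.HodgeConjecture.Theorems.CancelByAnyClaimLattice

end
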